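import Literature.Geometry.Symplectic.TwistingHomotopyProofs
import Literature.Geometry.Symplectic.TwoHandleIsotopyProofs
import Literature.Geometry.Symplectic.SteinOrientation
import HarnessLib

/-!
# Akbulut–Matveyev's defect-zero criterion (D) is Eliashberg's theorem (E2): the merged form

Topic `Literature/Geometry/Symplectic`.  Akbulut–Matveyev (1998), §3, after quoting Eliashberg's
theorem (their Thm. 2 (2) = Gompf 1998, Thm. 1.3 (b)–(c): 2-handles attached to a PC manifold
along Legendrian knots with framing `tb - 1` give a PC manifold — the named fact **E2**,
`Gompf1998_thm13_twoHandles`, `SteinTwoHandles.lean`), derive in two sentences: *"If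
`tb(K) ≥ f + 1` then by `C⁰`-small smooth isotopy of `K` we can decrease Thurston–Bennequin
invariant of `K` and make it equal to `f + 1`.  Therefore, by a theorem of Eliashberg, manifold
`Z ∪ h` possesses PC structure. … So if the defect is zero, the PC structure extends over
2-handles"* (p. 3 of arXiv:math/0010166).  That consequence — **D**, the defect-zero criterion —
is a **theorem** of the tree *relative to the named facts it rests on in print*:

* `AkbulutMatveyev1998_defectZero_of_E2_ST_ISO` — from E2, ST (`Gompf1998_addLeftTwists`, the
  quoted stabilisation sentence; Gompf 1998, §1) and ISO
  (`HandleAttachingMap.isMultiAttachment_of_linkIsotopyInBoundary`, the attached manifold only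
  depends on the framed isotopy class of the attaching link; Kosinski VI §6): if `P` is a compact
  Stein `W` with finitely many 2-handles attached along attaching maps whose attaching circles
  are Legendrian and whose handle framings have defect `0`, then `P` admits a Stein structure.
  The §3 argument itself is `AkbulutMatveyev1998_defectZero_of_facts` (`DefectZeroProofs.lean`);
  all its further inputs are theorems: TUBE `exists_handleAttachingMap_of_isKnotFraming_holds`
  (`TwoHandleIsotopyProofs.lean`), TH `twisting_eq_of_framingHomotopic_holds`
  (`TwistingHomotopyProofs.lean`), the orientability of Stein domains
  `SteinStructure.isOrientable` (`SteinOrientation.lean`), "handle framings are knot framings"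
  and "attaching circles are knots in `∂W`" (`AttachingFramingProofs.lean`,
  `AttachingCircleProofs.lean`);
* `AkbulutMatveyev1998_defectZero_of_E2_ST_ISO_TUBE` — the same with TUBE kept as a hypothesis
  (the form proved before TUBE was discharged; kept for its users);
* `AkbulutMatveyev1998_defectZero_iff_thm13_twoHandles` — under ST and ISO, **D ⟺ E2** (the
  direction D ⟹ E2 is immediate: twisting `-1` is defect `0`, `SteinStructure.defect_eq_zero_iff`);
* `AkbulutMatveyev1998_defectZero_of_E2_ST_ISO_single` — one handle: AM's *"`Z ∪ h` possesses
  PC structure"*.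

## D merged back into Eliashberg's theorem (review D-0026, 2026-08-15)

D was formerly recorded as a separate **named fact** `AkbulutMatveyev1998_defectZero` of
`SteinTwoHandles.lean`, with the rendering (verbatim):

> `∀ (W P : Type) [TopologicalSpace W] [T2Space W] [ChartedSpace (EuclideanHalfSpace 4) W]`
> `[IsManifold (𝓡∂ 4) ∞ W] [CompactSpace W] [TopologicalSpace P]`
> `[ChartedSpace (EuclideanHalfSpace 4) P] [IsManifold (𝓡∂ 4) ∞ P] [CompactSpace P]`
> `(S : SteinStructure W) (ι : Type) [Finite ι] (h : ι → HandleAttachingMap 3 2 W),`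
> `HandleAttachingMap.IsMultiAttachment h (𝓡∂ 4) P →`
> `(∀ i, IsLegendrianKnot S.J (h i).attachingCircle) →`
> `(∀ i, S.defect (h i).attachingCircle (h i).attachingFraming = 0) → IsSteinDomain P`

— the statement of E2 with the framing hypothesis `twisting = -1` relaxed to `defect = 0`
(`twisting ≤ -1`).  The review of that decomposition child (its proving seat had triaged it XL:
D ⟹ E2 is one line, so no proof of D avoids Eliashberg's theorem) found it **mis-cut**: in print
D is not a distinct result but the two-sentence corollary of E2 quoted above, and that
derivation is already proved here, so as a named fact D only re-counted E2's debt (D ⟺ E2 under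
ST, ISO).  It has been **merged back**: the `def` is gone, and its statement — displayed above and
spelled out verbatim as the left-hand side of `AkbulutMatveyev1998_defectZero_iff_thm13_twoHandles`
and as the conclusion of `AkbulutMatveyev1998_defectZero_of_E2_ST_ISO` — is now a proved
consequence of E2, ST and ISO, which the proof obligation of the parent
`AkbulutMatveyev1998_thm3` (§4: *"reducing defect of `h` … we obtain PC manifolds"*) consumes in
this form.  No statement was weakened: every former consumer of `(hD : AkbulutMatveyev1998_defectZero)`
is served by `AkbulutMatveyev1998_defectZero_of_E2_ST_ISO hE hST hISO` with the same binders.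

## References

* S. Akbulut, R. Matveyev, *A convex decomposition theorem for 4-manifolds*, IMRN 1998, no. 7,
  371–381 (arXiv:math/0010166), Thm. 2 and §3 (p. 3). [AkbulutMatveyev1998]
* R. E. Gompf, *Handlebody construction of Stein surfaces*, Ann. of Math. 148 (1998), 619–693
  (arXiv:math/9803019), §1 (p. 4: "adds any number of left (negative) twists to the canonical
  framing") and Thm. 1.3 (pp. 8–9). [Gompf1998]
* A. A. Kosinski, *Differential Manifolds* (1993), VI §6. [Kosinski1993]
-/

noncomputable section

open scoped Manifold ContDiff Topology

namespace Literature.Geometry.Symplectic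

open Literature.Topology.FourManifolds

/-- **The defect-zero criterion (Akbulut–Matveyev 1998, §3) from Eliashberg's theorem (E2),
stabilisation (ST) and isotopy invariance of the attachment (ISO).**  *"So if the defect is
zero, the PC structure extends over 2-handles"*: let `W` be a compact (Hausdorff) smooth
4-manifold with boundary carrying a Stein structure `S`, and `P` be `W` with finitely many
2-handles attached simultaneously along attaching maps `h i` (`HandleAttachingMap.IsMultiAttachment`);
if every attaching circle is a Legendrian knot for `S.J` and every handle framing has defect `0`
(`SteinStructure.defect`, i.e. twisting `≤ -1` relative to the canonical framing), then `P`
admits a Stein structure.  Proof = the paper's: stabilise each attaching circle by a `C⁰`-small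
isotopy until the carried framing has twisting `-1` (ST), re-attach along the stabilised framed
link (TUBE, proved; ISO), compare twisting numbers (TH, proved) and apply E2
(`AkbulutMatveyev1998_defectZero_of_facts`, with `W` oriented by the complex orientation of `S`).
[cite: AkbulutMatveyev1998, §3] -/
theorem AkbulutMatveyev1998_defectZero_of_E2_ST_ISO (hE : Gompf1998_thm13_twoHandles)
    (hST : Gompf1998_addLeftTwists)
    (hISO : HandleAttachingMap.isMultiAttachment_of_linkIsotopyInBoundary)
    (W P : Type) [TopologicalSpace W] [T2Space W] [ChartedSpace (EuclideanHalfSpace 4) W]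
    [IsManifold (𝓡∂ 4) ∞ W] [CompactSpace W] [TopologicalSpace P]
    [ChartedSpace (EuclideanHalfSpace 4) P] [IsManifold (𝓡∂ 4) ∞ P] [CompactSpace P]
    (S : SteinStructure W) (ι : Type) [Finite ι] (h : ι → HandleAttachingMap 3 2 W)
    (hP : HandleAttachingMap.IsMultiAttachment h (𝓡∂ 4) P)
    (hLeg : ∀ i, IsLegendrianKnot S.J (h i).attachingCircle)
    (hd : ∀ i, S.defect (h i).attachingCircle (h i).attachingFraming = 0) : IsSteinDomain P :=
  AkbulutMatveyev1998_defectZero_of_facts hE hST hISO exists_handleAttachingMap_of_isKnotFraming_holds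
    twisting_eq_of_framingHomotopic_holds W P S.isOrientable S ι h hP hLeg hd

/-- The same derivation with the realisation of framed knots by attaching maps (TUBE,
`exists_handleAttachingMap_of_isKnotFraming`) kept as a hypothesis — the form in which the §3
argument was first assembled (TH and the orientability of Stein domains being theorems).
[cite: AkbulutMatveyev1998, §3] -/
theorem AkbulutMatveyev1998_defectZero_of_E2_ST_ISO_TUBE (hE : Gompf1998_thm13_twoHandles)
    (hST : Gompf1998_addLeftTwists)
    (hISO : HandleAttachingMap.isMultiAttachment_of_linkIsotopyInBoundary)
    (hT : exists_handleAttachingMap_of_isKnotFraming)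
    (W P : Type) [TopologicalSpace W] [T2Space W] [ChartedSpace (EuclideanHalfSpace 4) W]
    [IsManifold (𝓡∂ 4) ∞ W] [CompactSpace W] [TopologicalSpace P]
    [ChartedSpace (EuclideanHalfSpace 4) P] [IsManifold (𝓡∂ 4) ∞ P] [CompactSpace P]
    (S : SteinStructure W) (ι : Type) [Finite ι] (h : ι → HandleAttachingMap 3 2 W)
    (hP : HandleAttachingMap.IsMultiAttachment h (𝓡∂ 4) P)
    (hLeg : ∀ i, IsLegendrianKnot S.J (h i).attachingCircle)
    (hd : ∀ i, S.defect (h i).attachingCircle (h i).attachingFraming = 0) : IsSteinDomain P :=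
  AkbulutMatveyev1998_defectZero_of_facts hE hST hISO hT twisting_eq_of_framingHomotopic_holds
    W P S.isOrientable S ι h hP hLeg hd

/-- **D ⟺ E2 under ST and ISO.**  The defect-zero criterion of Akbulut–Matveyev (1998), §3 —
spelled out on the left exactly as it was formerly recorded as the named fact
`AkbulutMatveyev1998_defectZero` (see the module docstring) — is equivalent to Eliashberg's
theorem `Gompf1998_thm13_twoHandles`: `⟹` because framing `tb - 1` (twisting `-1`) is defect
`0` with equality (`SteinStructure.defect_eq_zero_iff`), `⟸` by
`AkbulutMatveyev1998_defectZero_of_E2_ST_ISO`. [cite: AkbulutMatveyev1998, §3] -/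
theorem AkbulutMatveyev1998_defectZero_iff_thm13_twoHandles (hST : Gompf1998_addLeftTwists)
    (hISO : HandleAttachingMap.isMultiAttachment_of_linkIsotopyInBoundary) :
    (∀ (W P : Type) [TopologicalSpace W] [T2Space W] [ChartedSpace (EuclideanHalfSpace 4) W]
      [IsManifold (𝓡∂ 4) ∞ W] [CompactSpace W] [TopologicalSpace P]
      [ChartedSpace (EuclideanHalfSpace 4) P] [IsManifold (𝓡∂ 4) ∞ P] [CompactSpace P]
      (S : SteinStructure W) (ι : Type) [Finite ι] (h : ι → HandleAttachingMap 3 2 W),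
      HandleAttachingMap.IsMultiAttachment h (𝓡∂ 4) P →
      (∀ i, IsLegendrianKnot S.J (h i).attachingCircle) →
      (∀ i, S.defect (h i).attachingCircle (h i).attachingFraming = 0) →
      IsSteinDomain P) ↔ Gompf1998_thm13_twoHandles := by
  constructor
  · intro hD W P _ _ _ _ _ _ _ _ _ S ι _ h hP hLeg htw
    exact hD W P S ι h hP hLeg fun i => (S.defect_eq_zero_iff _ _).2 (le_of_eq (htw i))
  · intro hE W P _ _ _ _ _ _ _ _ _ S ι _ h hP hLeg hd
    exact AkbulutMatveyev1998_defectZero_of_E2_ST_ISO hE hST hISO W P S ι h hP hLeg hd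

section Single

variable {W P : Type} [TopologicalSpace W] [T2Space W] [ChartedSpace (EuclideanHalfSpace 4) W]
  [IsManifold (𝓡∂ 4) ∞ W] [CompactSpace W] [TopologicalSpace P]
  [ChartedSpace (EuclideanHalfSpace 4) P] [IsManifold (𝓡∂ 4) ∞ P] [CompactSpace P]

/-- **One 2-handle of defect `0`** (AM §3: *"If `tb(K) ≥ f + 1` then … by a theorem of
Eliashberg, manifold `Z ∪ h` possesses PC structure"*), under E2, ST and ISO (index type `Unit`).
[cite: AkbulutMatveyev1998, §3] -/
theorem AkbulutMatveyev1998_defectZero_of_E2_ST_ISO_single (hE : Gompf1998_thm13_twoHandles)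
    (hST : Gompf1998_addLeftTwists)
    (hISO : HandleAttachingMap.isMultiAttachment_of_linkIsotopyInBoundary)
    (S : SteinStructure W) (h₁ : HandleAttachingMap 3 2 W)
    (hP : HandleAttachingMap.IsMultiAttachment (fun _ : Unit => h₁) (𝓡∂ 4) P)
    (hLeg : IsLegendrianKnot S.J h₁.attachingCircle)
    (hd : S.defect h₁.attachingCircle h₁.attachingFraming = 0) : IsSteinDomain P :=
  AkbulutMatveyev1998_defectZero_of_E2_ST_ISO hE hST hISO W P S Unit (fun _ => h₁) hP
    (fun _ => hLeg) fun _ => hd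

end Single

end Literature.Geometry.Symplectic

end
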